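import Mathlib
import Summits.QuantumFields.YangMills.Theorems.ConvexGribovBodyContinuumLegGivenGapStubRpShift
import HarnessLib

/-!
# `ContinuumFromLatticeGap` (stmt-QuantumFields-15915), line `registered` (reshape 6): `stub_pairingDictionary`

Support file for the crux item stmt-QuantumFields-15915
(`Summit.QuantumFields.YangMills.Theses.GronwallGap.ContinuumFromLatticeGap`), registered stub
`stub_pairingDictionary` of the line `registered` (reshape 6): **the pairing dictionary** between the decay
leg's reflected pairing on the odd torus `2S+1` — Wave 0's torus bond reflection `Θ_T = GaugeConfig.timeReflect`
(`t ↦ 1 − t`) INSIDE the periodic lift `torusLift`, the second copy translated by `j` lattice time units — and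
the `latticeConnectedCorr` currency of the landed RP core of stmt-QuantumFields-15828, which speaks the `ℤ⁴`
bond reflection `Θ = gaugeTimeReflect` (plane `x₀ = −1/2`) OUTSIDE the lift.

**Statement.** For a real observable `Y` of `ℤ⁴` gauge fields, every `β`, `S` and `j : ℕ`,
`∫ Y(lift (Θ_T U)) · Y(τʲ lift U) dμ − (∫ Y(lift U) dμ)² = corr(F∘Θ, F; j)` with `F := Y ∘ configShift e₀`
(`τᶜ = configShift (−c e₀)`, `μ = wilsonMeasure r.ρ β` on the torus of side `2S+1`).

**Proof.** (i) The lift intertwiners `Θ ∘ lift = lift ∘ T_{−2e₀} ∘ Θ_T`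
(`Reconstructible.gaugeTimeReflect_torusLift`) and `configShift v ∘ lift = lift ∘ T_{proj v}`
(`configShift_torusLift`) give `lift (Θ_T U) = τ^{−2} Θ (lift U)` (`pairingDictionary_torusLift_timeReflect`).
(ii) Hence the pairing is `∫ Y(τ^{−2} Θ Ũ) Y(τʲ Ũ) = ∫ Y(Θ Ũ) Y(τ^{j−2} Ũ)` by the shift identity
`rpShift_integral_shift_pair` (`a = −2`, `c = j`).  (iii) On the right, `configShift e₀ = τ^{−1}` and
`τ^{−1} τʲ = τ^{j−1}`, so the pairing of `corr(F∘Θ, F; j)` is `∫ Y(τ^{−1} Θ Ũ) Y(τ^{j−1} Ũ) = ∫ Y(Θ Ũ) Y(τ^{j−2} Ũ)`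
(shift identity with `a = −1`, `c = j − 1`); both means of `F` equal `∫ Y(Ũ)` by translation invariance
(`rpShift_integral_configShift_torusLift`) and reflection invariance
(`rpShift_integral_gaugeTimeReflect_torusLift`) of the torus Wilson state along the lift.  The measurability
and boundedness hypotheses are not used (the invariances hold for every integrand).

References: K. Osterwalder, E. Seiler, Ann. Phys. 110 (1978) 440, §2 (folklore manipulations).
No definitions, no facts; Mathlib + the landed `stub_rpShift` support file only. [folklore]
-/

noncomputable section

namespace Summit.QuantumFields.YangMills.Theorems.ContinuumFromLatticeGap

open MeasureTheory
open Literature.MathematicalPhysics.QuantumFieldTheory Literature.MathematicalPhysics.QuantumLattice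
  Literature.MathematicalPhysics.AQFT Literature.Probability.LatticeModels
open Summit.QuantumFields.YangMills.Theorems.ClusteringToYangMills
open Summit.QuantumFields.YangMills.Theorems.ContinuumLegGivenGap

/-- **The lift of the torus reflection is a shifted bond reflection of the lift**:
`lift (Θ_T U) = τ^{−2} Θ (lift U)`, i.e.
`torusLift L (GaugeConfig.timeReflect U) = configShift (2e₀) (gaugeTimeReflect (torusLift L U))`
(`gaugeTimeReflect_torusLift` and `configShift_torusLift`; `proj (2e₀) − 2e₀ = 0` on the torus). [folklore] -/
theorem pairingDictionary_torusLift_timeReflect {G : Type} [Group G] [MeasurableSpace G] (L : ℕ)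
    (U : GaugeConfig 4 L G) :
    torusLift L (GaugeConfig.timeReflect U) =
      configShift (-(Pi.single 0 (-2 : ℤ))) (gaugeTimeReflect (torusLift L U)) := by
  rw [Reconstructible.gaugeTimeReflect_torusLift, configShift_torusLift,
    Reconstructible.torusConfigShift_torusConfigShift]
  have h0 : Torus.proj L (-(Pi.single 0 (-2 : ℤ)) : Literature.Probability.LatticeModels.Site 4) +
      Pi.single 0 (-2) = 0 := by
    funext i
    by_cases hi : i = 0
    · subst hi; simp
    · simp [hi]
  rw [h0, Reconstructible.torusConfigShift_zero]

/-- `configShift e₀ = τ^{−1}`: `configShift (Pi.single 0 1) W = configShift (−(Pi.single 0 (−1))) W`. [folklore] -/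
theorem pairingDictionary_configShift_single_one {G : Type} [MeasurableSpace G] (W : LGConfig 4 G) :
    configShift (Pi.single 0 (1 : ℤ) : Literature.Probability.LatticeModels.Site 4) W =
      configShift (-(Pi.single 0 (-1 : ℤ))) W := by
  rw [Pi.single_neg, neg_neg]

/-- **The pairing dictionary** (stub `stub_pairingDictionary` of the line `registered`, reshape 6, of
stmt-QuantumFields-15915).  The decay leg's reflected pairing on the odd torus — the torus reflection `θ t = 1 − t`
INSIDE the periodic lift, the second copy time-translated by `j` — minus the squared mean is `latticeConnectedCorr`
of the pair `(F∘Θ, F)` with `F := Y ∘ configShift e₀` and `Θ = gaugeTimeReflect` (the `ℤ⁴` bond reflection in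
`x₀ = −1/2`) at separation `j`: `lift ∘ Θ_T = τ^{−2} ∘ Θ ∘ lift` (`pairingDictionary_torusLift_timeReflect`), the
shift identity `rpShift_integral_shift_pair` on both sides (`a = −2, c = j` resp. `a = −1, c = j − 1`), and
translation / reflection invariance of the torus Wilson state along the lift for the means. [folklore] -/
theorem stub_pairingDictionary :
    ∀ (G : Type) [Group G] [TopologicalSpace G] [IsTopologicalGroup G] [CompactSpace G]
      [MeasurableSpace G] [BorelSpace G] (r : LatticeRep G) (β : ℝ) (S : ℕ) (Y : LGConfig 4 G → ℝ),
      Measurable Y → (∃ C : ℝ, ∀ U, |Y U| ≤ C) → ∀ j : ℕ,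
        (∫ U, Y (torusLift (2 * S + 1) (GaugeConfig.timeReflect U)) *
              Y (configShift (-Pi.single 0 (j : ℤ)) (torusLift (2 * S + 1) U))
            ∂(wilsonMeasure r.ρ β : Measure (GaugeConfig 4 (2 * S + 1) G))) -
          (∫ U, Y (torusLift (2 * S + 1) U) ∂(wilsonMeasure r.ρ β : Measure (GaugeConfig 4 (2 * S + 1) G))) ^ 2 =
        latticeConnectedCorr r.ρ β (2 * S + 1)
          ((Y ∘ configShift (Pi.single 0 1)) ∘ gaugeTimeReflect) (Y ∘ configShift (Pi.single 0 1)) j := by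
  intro G _ _ _ _ _ _ r β S Y _hY _hYb j
  -- (ii) the left pairing: `lift ∘ Θ_T = τ^{-2} Θ lift`, then the shift identity with `a = -2`, `c = j`
  simp_rw [pairingDictionary_torusLift_timeReflect]
  rw [rpShift_integral_shift_pair r.ρ β (2 * S + 1) Y Y (-2) j]
  -- (iii) the right-hand side
  unfold latticeConnectedCorr
  simp only [Function.comp_apply]
  -- the means of `F = Y ∘ configShift e₀` and of `F ∘ Θ` are the mean of `Y`
  have hmean : ∫ U, Y (configShift (Pi.single 0 1) (torusLift (2 * S + 1) U)) ∂(wilsonMeasure r.ρ β) =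
      ∫ U, Y (torusLift (2 * S + 1) U) ∂(wilsonMeasure (d := 4) (L := 2 * S + 1) r.ρ β) :=
    rpShift_integral_configShift_torusLift r.ρ β (2 * S + 1) (Pi.single 0 1) Y
  have hmeanΘ :
      ∫ U, Y (configShift (Pi.single 0 1) (gaugeTimeReflect (torusLift (2 * S + 1) U))) ∂(wilsonMeasure r.ρ β) =
        ∫ U, Y (torusLift (2 * S + 1) U) ∂(wilsonMeasure (d := 4) (L := 2 * S + 1) r.ρ β) := by
    rw [← hmean]
    exact rpShift_integral_gaugeTimeReflect_torusLift r.ρ r.continuous β (2 * S + 1)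
      (fun W => Y (configShift (Pi.single 0 1) W))
  rw [hmean, hmeanΘ]
  -- the right pairing: `configShift e₀ = τ^{-1}`, `τ^{-1} τ^j = τ^{j-1}`, shift identity with `a = -1`, `c = j-1`
  simp_rw [pairingDictionary_configShift_single_one, rpShift_configShift_configShift]
  rw [rpShift_integral_shift_pair r.ρ β (2 * S + 1) Y Y (-1) ((j : ℤ) + -1)]
  have hj : (-1 : ℤ) + ((j : ℤ) + -1) = -2 + j := by ring
  rw [hj, sq]

end Summit.QuantumFields.YangMills.Theorems.ContinuumFromLatticeGap

end
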